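import Summits.HodgeConjecture.CorCM.Census.DecicWeil23Multi
import Summits.HodgeConjecture.CorCM.Census.DecicWeil23TripleTwoTransitive
import HarnessLib

/-!
# ANY NUMBER `r` of `(2,3)`-types over one DECIC CM field: the DEFECT LAW from `2`-TRANSITIVITY and INDEPENDENCE of the
# position columns — the averaged equation solved once for every configuration

COR-CM (cell `pub-hodgecm2`), seat b30 gen 24 (2026-08-22); count-neutral own lane DECIC-MULTI, part 2 (sequel of
`Census/DecicWeil23Multi`).  One bookkeeping definition (`IndepPos`, the independence criterion) and theorems of the finite model;
no named fact, no geometry, no `sorry`, no `decide`.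

§1 THE CRITERION.  `IndepPos P` — the integer columns `𝟙` and `𝟙_{I_m}` (`I_m = {a | P m a}`, `m < r`) of length five are linearly
independent, stated as the solve it is used for: `w + Σ_{m ∋ x} t_m = 0` for all `x < 5` forces `w = 0` and `t = 0`.  By the exact
census of gens 22–23 this is EXACTLY the condition under which the balanced weights of every product of copies of `E, B₁, …, B_r`
are generated by conjugate pairs, Weil sixfold and tenfold weights (always for `r ≤ 3` distinct types; for four types off the `15`
four-cycles and the `10` «triangle + disjoint edge»; never for `r ≥ 5`).
§2 THE DEFECT LAW (`defectM_of_signed_twoTransitive`).  For `R ⊆ Sym(5)` closed under composition and `2`-transitive and positions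
with `#I_m = 2`, the signed equations `e + Σ_{m,a} ± d_{m,a} = 0` (sign `+` iff `π a ∈ I_m`) at all `π ∈ R` give, by the fibre
AVERAGING of gen 23 (`DecicWeil23Triple.fourMul_add_sum_eq_zero_of_twoTransitive'`, slots `Fin r`), for all `b, x`:
`w_b + Σ_{m ∋ x} t_{m,b} = 0` with `w_b = 4e − 4 Σ_m d_{m,b}`, `t_{m,b} = 10 d_{m,b} − 2 Σ_a d_{m,a}`; `IndepPos` kills `w` and `t`,
whence `d_{m,a} = d_{m,0}` for all `m, a` AND `e = Σ_m d_{m,0}`.  Conversely the defect law gives the signed equation at EVERY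
permutation (`signedM_of_defectM`), so an `R`-balanced configuration is balanced everywhere (`balancedM_of_modelBalancedM`).
§3 `exists_defectM_of_modelBalancedM` — the defect law for the fibre counts of a balanced configuration (input of EXTRACTION,
`Census/DecicWeil23MultiExtraction`).
[cite: DixonMortimer1996, §2.1] [cite: MoonenZarhin1995Duke, Thm. 2.4] [cite: GaoUllmo2025, Thm 3.1] [cite: Pohlmann1968, Thm 1]

## References
* [DixonMortimer1996] J. D. Dixon, B. Mortimer, *Permutation Groups*, GTM 163 (1996), §2.1.  [MoonenZarhin1995Duke] B. Moonen,
  Yu. Zarhin, Duke Math. J. 77 (1995), Thm. 2.4.  [GaoUllmo2025] Z. Gao, E. Ullmo, J. Inst. Math. Jussieu 25 (2025), Thm 3.1.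
  [Pohlmann1968] H. Pohlmann, Ann. of Math. 88 (1968), Thm 1.

## Provenance
Exact python first (gens 22–23, `HOME/pub-hodgecm2-b30/decic-23pair/multi_types.py`); this file proves the sufficiency of the
independence criterion for every `r` at once (the representation-theoretic reason: the permutation module of a `2`-transitive
group is `𝟙 ⊕ V` with `V` irreducible, so the first moments over the point-stabiliser cosets see everything).
-/

namespace Summit.HodgeConjecture.CorCM.Census.DecicWeil23Multi

open Finset
open Summit.HodgeConjecture.CorCM.Census.DecicWeil23Triple (fourMul_add_sum_eq_zero_of_twoTransitive' sum_ite_mul_eq)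

variable {r : ℕ}

/-! ## §1 The independence criterion -/

/-- **THE INDEPENDENCE CRITERION `IndepPos P`**: the columns `𝟙, 𝟙_{I_1}, …, 𝟙_{I_r}` (`I_m = {a | P m a}`) of the `5 × (r+1)`
incidence matrix are linearly independent over `ℤ` — `w + Σ_{m ∋ x} t_m = 0` for all five `x` forces `w = t_1 = ⋯ = t_r = 0`.
[cite: MoonenZarhin1995Duke, Thm. 2.4] -/
def IndepPos (P : Fin r → Fin 5 → Bool) : Prop :=
  ∀ (w : ℤ) (t : Fin r → ℤ), (∀ x : Fin 5, w + ∑ m : Fin r, (if P m x then t m else 0) = 0) → w = 0 ∧ ∀ m, t m = 0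

/-- Independent positions are pairwise distinct: `P` is injective. [folklore] -/
theorem IndepPos.injective {P : Fin r → Fin 5 → Bool} (hind : IndepPos P) : Function.Injective P := by
  classical
  intro m m' h
  by_contra hne
  have key := (hind 0 (fun l => if l = m then 1 else if l = m' then -1 else 0) fun x => ?_).2 m
  · rw [if_pos rfl] at key
    exact one_ne_zero key
  · rw [zero_add]
    have hsplit : ∀ l : Fin r, (if P l x then (if l = m then (1 : ℤ) else if l = m' then -1 else 0) else 0) =
        (if l = m then (if P m x then (1 : ℤ) else 0) else 0) + (if l = m' then (if P m' x then (-1 : ℤ) else 0) else 0) := by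
      intro l
      by_cases hlm : l = m
      · subst hlm
        rw [if_neg hne]
        cases P l x <;> simp [hne]
      · by_cases hlm' : l = m'
        · subst hlm'
          rw [if_neg hlm]
          cases P l x <;> simp [hlm]
        · rw [if_neg hlm, if_neg hlm']
          split_ifs <;> simp
    rw [Finset.sum_congr rfl fun l _ => hsplit l, Finset.sum_add_distrib, Finset.sum_ite_eq' Finset.univ m,
      Finset.sum_ite_eq' Finset.univ m', if_pos (Finset.mem_univ _), if_pos (Finset.mem_univ _), h]
    cases P m' x <;> simp

/-! ## §2 Signs, the averaged equation summed out, the defect law -/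

/-- The sign `ε_m(y) = ±1` of the pair `y` for the type of slot `m` at positions `P`. [folklore] -/
def sgnM (P : Fin r → Fin 5 → Bool) (m : Fin r) (y : Fin 5) : ℤ := if P m y then 1 else -1

variable (P : Fin r → Fin 5 → Bool)

/-- `± t = ε_m(y) · t`. [folklore] -/
theorem ite_eq_sgnM_mul (m : Fin r) (y : Fin 5) (t : ℤ) : (if P m y then t else -t) = sgnM P m y * t := by
  unfold sgnM
  split_ifs <;> ring

/-- `Σ_y ε_m(y) = 2 − 3 = −1` for a position set of two pairs. [folklore] -/
theorem sum_sgnM {m : Fin r} (hP : ((univ : Finset (Fin 5)).filter fun a => P m a = true).card = 2) :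
    ∑ y : Fin 5, sgnM P m y = -1 := by
  have h5 : ((univ : Finset (Fin 5)).filter fun a => P m a = true).card +
      ((univ : Finset (Fin 5)).filter fun a => ¬ P m a = true).card = 5 := by
    rw [Finset.card_filter_add_card_filter_not, Finset.card_univ, Fintype.card_fin]
  unfold sgnM
  rw [Finset.sum_ite, Finset.sum_const, Finset.sum_const, nsmul_eq_mul, nsmul_eq_mul]
  omega

/-- Summing out `a` in the averaged equation of slot `m`: `−4 f b + (x ∈ I_m ? 10 f b − 2 Σ_a f a : 0)`. [folklore] -/
theorem sum_probe_termM (m : Fin r) (x b : Fin 5) (f : Fin 5 → ℤ) :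
    ∑ a : Fin 5, (if a = b then 4 * sgnM P m x else -1 - sgnM P m x) * f a =
      -4 * f b + (if P m x then 10 * f b - 2 * ∑ a : Fin 5, f a else 0) := by
  rw [sum_ite_mul_eq]
  unfold sgnM
  split_ifs <;> ring

variable (R : Finset (Equiv.Perm (Fin 5)))

/-- **THE DEFECT LAW FROM `2`-TRANSITIVITY AND INDEPENDENCE (any number of types).**  For `R ⊆ Sym(5)` closed under composition
and `2`-transitive, positions `P` with `#I_m = 2` and `IndepPos P`, the signed equations `e + Σ_{m,a} ± d_{m,a} = 0` (sign `+` iff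
`π a ∈ I_m`) at all `π ∈ R` force `d_{m,a} = d_{m,0}` for all `m, a` AND `e = Σ_m d_{m,0}`. [cite: MoonenZarhin1995Duke, Thm. 2.4]
[cite: GaoUllmo2025, Thm 3.1] [cite: DixonMortimer1996, §2.1] -/
theorem defectM_of_signed_twoTransitive (hP : ∀ m, ((univ : Finset (Fin 5)).filter fun a => P m a = true).card = 2)
    (hind : IndepPos P) (hmul : ∀ π₁ ∈ R, ∀ π₂ ∈ R, π₁ * π₂ ∈ R)
    (h2 : ∀ a b x y : Fin 5, a ≠ b → x ≠ y → ∃ π ∈ R, π a = x ∧ π b = y) (e : ℤ) (d : Fin r → Fin 5 → ℤ)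
    (h : ∀ π ∈ R, e + ∑ m : Fin r, ∑ a : Fin 5, (if P m (π a) then d m a else -d m a) = 0) :
    (∀ (m : Fin r) (a : Fin 5), d m a = d m 0) ∧ e = ∑ m : Fin r, d m 0 := by
  have h' : ∀ π ∈ R, e + ∑ m : Fin r, ∑ a : Fin 5, sgnM P m (π a) * d m a = 0 := by
    intro π hπ
    rw [← h π hπ]
    simp only [ite_eq_sgnM_mul]
  have key := fourMul_add_sum_eq_zero_of_twoTransitive' R (sgnM P) (fun _ => -1) (fun m => sum_sgnM P (hP m)) hmul h2 e d h'
  -- the probe equations in the form `w_b + Σ_{m ∋ x} t_{m,b} = 0`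
  have hx : ∀ b x : Fin 5, (4 * e - 4 * ∑ m : Fin r, d m b) +
      ∑ m : Fin r, (if P m x then 10 * d m b - 2 * ∑ a : Fin 5, d m a else 0) = 0 := by
    intro b x
    have hb := key b x
    simp only [sum_probe_termM, Finset.sum_add_distrib, ← Finset.mul_sum] at hb
    linarith
  have ht : ∀ b : Fin 5, 4 * e - 4 * ∑ m : Fin r, d m b = 0 ∧ ∀ m : Fin r, 10 * d m b - 2 * ∑ a : Fin 5, d m a = 0 :=
    fun b => hind _ _ (hx b)
  have hd : ∀ (m : Fin r) (b : Fin 5), 5 * d m b = ∑ a : Fin 5, d m a := by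
    intro m b
    have h₁ := (ht b).2 m
    linarith
  have hd' : ∀ (m : Fin r) (a : Fin 5), d m a = d m 0 := by
    intro m a
    have h₁ := hd m a; have h₂ := hd m 0
    linarith
  refine ⟨hd', ?_⟩
  have h₁ := (ht 0).1
  linarith

/-- **Conversely, the defect law gives the signed equation at EVERY permutation of the pairs.** [folklore] -/
theorem signedM_of_defectM (hP : ∀ m, ((univ : Finset (Fin 5)).filter fun a => P m a = true).card = 2)
    (π : Equiv.Perm (Fin 5)) {e : ℤ} {d : Fin r → Fin 5 → ℤ}
    (hd : ∀ (m : Fin r) (a : Fin 5), d m a = d m 0) (he : e = ∑ m : Fin r, d m 0) :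
    e + ∑ m : Fin r, ∑ a : Fin 5, (if P m (π a) then d m a else -d m a) = 0 := by
  have key : ∀ m : Fin r, ∑ a : Fin 5, (if P m (π a) then d m a else -d m a) = -d m 0 := by
    intro m
    rw [Finset.sum_congr rfl fun a _ => by rw [hd m a, ite_eq_sgnM_mul], ← Finset.sum_mul,
      Equiv.sum_comp π (sgnM P m), sum_sgnM P (hP m)]
    ring
  rw [Finset.sum_congr rfl fun m _ => key m, Finset.sum_neg_distrib, he]
  ring

/-! ## §3 The defect law for balanced configurations -/

variable {α : Type*} {P R} {v : α → PtM r}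

/-- **The defect law of fibre counts balanced under `R`.** [cite: MoonenZarhin1995Duke, Thm. 2.4] [cite: GaoUllmo2025, Thm 3.1] -/
theorem defect_of_balancedM (hP : ∀ m, ((univ : Finset (Fin 5)).filter fun a => P m a = true).card = 2) (hind : IndepPos P)
    (hmul : ∀ π₁ ∈ R, ∀ π₂ ∈ R, π₁ * π₂ ∈ R) (h2 : ∀ a b x y : Fin 5, a ≠ b → x ≠ y → ∃ π ∈ R, π a = x ∧ π b = y)
    (N : PtM r → ℕ) (hN : ∀ π ∈ R, 2 * ∑ y ∈ phiM P π, N y = ∑ y : PtM r, N y) :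
    (∀ (m : Fin r) (a : Fin 5), (N (Sum.inr (m, (a, true))) : ℤ) - N (Sum.inr (m, (a, false))) =
        (N (Sum.inr (m, (0, true))) : ℤ) - N (Sum.inr (m, (0, false)))) ∧
      (N (Sum.inl true) : ℤ) - N (Sum.inl false) =
        ∑ m : Fin r, ((N (Sum.inr (m, (0, true))) : ℤ) - N (Sum.inr (m, (0, false)))) :=
  defectM_of_signed_twoTransitive P R hP hind hmul h2 _
    (fun m a => (N (Sum.inr (m, (a, true))) : ℤ) - N (Sum.inr (m, (a, false)))) fun π hπ =>
      (balancedM_iff_signed P π N).1 (hN π hπ)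

/-- **`R`-BALANCED ⟹ BALANCED AT EVERY PERMUTATION.**  If `R` is closed under composition and `2`-transitive and the positions
are independent, a configuration balanced under `R` satisfies the balance equation at every permutation of the pairs.
[cite: MoonenZarhin1995Duke, Thm. 2.4] [cite: GaoUllmo2025, Thm 3.1] -/
theorem balancedM_of_modelBalancedM (hP : ∀ m, ((univ : Finset (Fin 5)).filter fun a => P m a = true).card = 2)
    (hind : IndepPos P) (hmul : ∀ π₁ ∈ R, ∀ π₂ ∈ R, π₁ * π₂ ∈ R)
    (h2 : ∀ a b x y : Fin 5, a ≠ b → x ≠ y → ∃ π ∈ R, π a = x ∧ π b = y) {T : Finset α}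
    (hT : ModelBalancedM P R v T) (π : Equiv.Perm (Fin 5)) : 2 * (T.filter fun x => v x ∈ phiM P π).card = T.card := by
  obtain ⟨hd, he⟩ := defect_of_balancedM hP hind hmul h2 (fun y => (T.filter fun x => v x = y).card) fun π hπ => by
    rw [← card_filter_mem_eq_sumM, ← card_eq_sumM v T]; exact hT π hπ
  rw [card_filter_mem_eq_sumM, card_eq_sumM v T, balancedM_iff_signed]
  exact signedM_of_defectM P hP π hd he

/-- Hence an `R`-balanced configuration is balanced under every larger set of permutations (in particular under `Sym(5)`).
[folklore] -/
theorem modelBalancedM_mono_right (hP : ∀ m, ((univ : Finset (Fin 5)).filter fun a => P m a = true).card = 2)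
    (hind : IndepPos P) (hmul : ∀ π₁ ∈ R, ∀ π₂ ∈ R, π₁ * π₂ ∈ R)
    (h2 : ∀ a b x y : Fin 5, a ≠ b → x ≠ y → ∃ π ∈ R, π a = x ∧ π b = y) {T : Finset α}
    (hT : ModelBalancedM P R v T) (R' : Finset (Equiv.Perm (Fin 5))) : ModelBalancedM P R' v T :=
  fun π _ => balancedM_of_modelBalancedM hP hind hmul h2 hT π

/-- **THE DEFECT LAW OF A BALANCED CONFIGURATION** (input of extraction): there are integers `t_m` with
`N(m, a, +) − N(m, a, −) = t_m` for all `m, a` and `N(τ) − N(τ̄) = Σ_m t_m`. [cite: MoonenZarhin1995Duke, Thm. 2.4]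
[cite: GaoUllmo2025, Thm 3.1] -/
theorem exists_defectM_of_modelBalancedM (hP : ∀ m, ((univ : Finset (Fin 5)).filter fun a => P m a = true).card = 2)
    (hind : IndepPos P) (hmul : ∀ π₁ ∈ R, ∀ π₂ ∈ R, π₁ * π₂ ∈ R)
    (h2 : ∀ a b x y : Fin 5, a ≠ b → x ≠ y → ∃ π ∈ R, π a = x ∧ π b = y) {T : Finset α} (hT : ModelBalancedM P R v T) :
    ∃ t : Fin r → ℤ, (∀ (m : Fin r) (a : Fin 5), ((T.filter fun x => v x = Sum.inr (m, (a, true))).card : ℤ) -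
        (T.filter fun x => v x = Sum.inr (m, (a, false))).card = t m) ∧
      ((T.filter fun x => v x = Sum.inl true).card : ℤ) - (T.filter fun x => v x = Sum.inl false).card = ∑ m : Fin r, t m := by
  obtain ⟨hd, he⟩ := defect_of_balancedM hP hind hmul h2 (fun y => (T.filter fun x => v x = y).card) fun π hπ => by
    rw [← card_filter_mem_eq_sumM, ← card_eq_sumM v T]; exact hT π hπ
  exact ⟨fun m => ((T.filter fun x => v x = Sum.inr (m, ((0 : Fin 5), true))).card : ℤ) -
      (T.filter fun x => v x = Sum.inr (m, ((0 : Fin 5), false))).card, fun m a => hd m a, he⟩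

/-- **A configuration whose fibre counts obey the defect law is balanced at every permutation** (used for the generating
parts: pair, sixfold and tenfold parts all have constant defects). [folklore] -/
theorem balancedM_of_defect (hP : ∀ m, ((univ : Finset (Fin 5)).filter fun a => P m a = true).card = 2) {T : Finset α}
    (π : Equiv.Perm (Fin 5)) (t : Fin r → ℤ)
    (hd : ∀ (m : Fin r) (a : Fin 5), ((T.filter fun x => v x = Sum.inr (m, (a, true))).card : ℤ) -
      (T.filter fun x => v x = Sum.inr (m, (a, false))).card = t m)
    (he : ((T.filter fun x => v x = Sum.inl true).card : ℤ) - (T.filter fun x => v x = Sum.inl false).card = ∑ m : Fin r, t m) :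
    2 * (T.filter fun x => v x ∈ phiM P π).card = T.card :=
  balancedM_of_signed (P := P) v (signedM_of_defectM P hP π
    (d := fun m a => ((T.filter fun x => v x = Sum.inr (m, (a, true))).card : ℤ) -
      (T.filter fun x => v x = Sum.inr (m, (a, false))).card)
    (fun m a => by rw [hd m a, hd m 0]) (by rw [he]; exact Finset.sum_congr rfl fun m _ => (hd m 0).symm))

end Summit.HodgeConjecture.CorCM.Census.DecicWeil23Multi
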